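import Summits.BirchSwinnertonDyer.BirchSwinnertonDyer.Theorems.GenusKolyvaginAtTwoMazurRubinCor34ii
import Summits.BirchSwinnertonDyer.BirchSwinnertonDyer.Theorems.GenusKolyvaginAtTwoGenusPrimitiveSupplyAtTwoTwistMenuFrame
import Summits.BirchSwinnertonDyer.BirchSwinnertonDyer.Theorems.GenusKolyvaginAtTwoGenusPrimitiveSupplyAtTwoTwistSelmerTransferDownRat
import Literature.NumberTheory.EllipticCurves.CanonicalPAdicHeightRestrictionProofs
import HarnessLib

/-!
# Route `GenusKolyvaginAtTwo`, crux #2 `GenusPrimitiveSupplyAtTwo` (stmt-BirchSwinnertonDyer-22136):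
# MAZUR–RUBIN 2010 COR. 3.4 (i) WITH ONE FINITE `T`-PRIME OVER `ℚ` IS A TREE THEOREM — discharge of the named fact
# `MazurRubin2010.cor34i_singleton_rat` (UP iff `Sel₂(E)` is strict at `q`, DOWN otherwise), for EVERY elliptic `E/ℚ`

Width seat `bsd-line-gk2-p4` g12 (cell `bsd-f1-sign2`). THEOREMS ONLY (no definition, no named fact, no `sorry`); helper
`--supports stmt-BirchSwinnertonDyer-22136`; no item of this route is closed by it; BSD is not proved by any of this.

WHAT. `Literature.NumberTheory.EllipticCurves.MazurRubin2010.cor34i_singleton_rat` (Mazur–Rubin, Invent. Math. 181 (2010), Cor. 3.4 (i)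
with the hypotheses of Prop. 3.3, `K = ℚ`, `T = {q}` one prime with `#E(ℚ_q)[2] = 2`): under the splitting list (additive primes,
multiplicative primes with even `ord_p Δ`, the prime `2`, the real place when `Δ > 0` all SPLIT in `F = ℚ(√d)`; multiplicative primes with
odd `ord_p Δ` UNRAMIFIED), `q` ramified with `#E(ℚ_q)[2] = 2` and every other ramified prime silent: for every model `W'` of `E^{(d)}`,
`Sel₂(E) ⊂ ker loc_q` ⟹ `#Sel₂(E^{(d)}) = 2·#Sel₂(E)`, and `Sel₂(E) ⊄ ker loc_q` ⟹ `#Sel₂(E) = 2·#Sel₂(E^{(d)})`. It was a cite-only named fact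
(consumers: gk2-p5's prime-Heegner-twin supply `supply_DEF1_of_not_strict_prime`, `cor34i_twin_prime_heegner`, gk2-p4's capstones,
`F1Sign2.TranspositionDoor`); the LEAD's `MazurRubin2010.cor34ii_rat_holds` (`T = ∅`) left it open «needs Kramer's parity». This file PROVES it
(`MazurRubin2010.cor34i_singleton_rat_holds`), with NO Galois-image hypothesis — the fact quantifies over every elliptic `E/ℚ`, so the typed
`MazurRubin2010.kramerParity` (binder `huniq`) could not serve; the `huniq`-free congruence for the FRAMED canonical identification does
(`natCard_selmerGroup_twist_directed_of_menu_frame`, previous file).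

HOW. The LEAD's dictionary (`…MazurRubinCor34iiDictionary`, `…TwistTamagawaOdd`) from the printed splitting list to the four-row place menu
at every finite place `≠ q` and at `∞`, verbatim; at `q`: `q` is odd (`2` splits ⟹ `d_F ≡ 1 (8)`), ramified primes do not split
(`legendreSym q d_F = 0`), hence `q` is a prime of GOOD reduction (additive / even-multiplicative would split, odd-multiplicative would be
unramified), `v_q(d) = 1` (`d` square-free) so `ι(√d) ∉ ℚ_q^{nr}`, `#E(ℚ_v)[2] = #E(ℚ_q)[2] = 2` (`natCard_ker_nsmul_adicCompletion_eq_padic`);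
strictness `Sel₂(E) ≤ strictLocalKer E ℚ_q 2` ⟺ every Selmer class localises to `0` at `v_q` (gk2-p5's dictionary §24, both directions);
then §79, and model invariance `natCard_selmerGroup_smul`.

References: [MazurRubin2010] arXiv:0904.3709 = Invent. Math. 181 (2010): Lemma 2.2 (i), Lemmas 2.9–2.11, Prop. 3.3, Cor. 3.4 (i) (DASH copy
p0008–p0010); [Kramer1981] Thm. 1, Props. 1, 2, 7; [KlagsbrunMazurRubin2013] Thm. 3.9, Lemma 5.2; [SilvermanAEC2009] VII.5 Prop. 5.1, X.5
Cor. 5.4; [MilneADT2006] I Thm. 2.8, 4.10.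
-/

set_option linter.dupNamespace false -- tree convention: `Summit.BirchSwinnertonDyer.BirchSwinnertonDyer.Theorems` (summit = sub-problem)
set_option autoImplicit false

noncomputable section

open scoped Classical ContRepresentation

namespace Summit.BirchSwinnertonDyer.BirchSwinnertonDyer.Theorems.GenusKolyTwistTamagawa

open WeierstrassCurve Field NumberField IsDedekindDomain Function Polynomial
open Literature.NumberTheory.EllipticCurves Literature.NumberTheory.GaloisRepresentations
open Literature.NumberTheory.GaloisRepresentations.IsNonarchimedeanLocalField
open Literature.NumberTheory.GaloisCohomology
open Rat.HeightOneSpectrum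
open Summit.BirchSwinnertonDyer.BirchSwinnertonDyer.Theorems.GenusKolyTwistLocal

/-! ## §H Strictness at `ℚ_q` in the localisation currency -/

/-- **`Sel₂(W) ≤ strictLocalKer W ℚ_p 2` gives: every `2`-Selmer class localises to `0` at the place `v` over `p`** (the converse
direction of gk2-p5's `exists_selmer_localization_ne_zero_of_not_le_strictLocalKer`: `strictLocalKer = torsionLocalKer` is invariant under
`ℚ_v ≃ ℚ_p` and is the kernel of the genuine localisation). [cite: MazurRubin2010, Def. 3.1] [cite: McCallumLMS1991, §3 (3)] -/
theorem forall_selmer_localization_eq_zero_of_le_strictLocalKer (W : WeierstrassCurve ℚ) [W.IsElliptic]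
    (v : HeightOneSpectrum (𝓞 ℚ))
    (h : haveI := Fact.mk (primesEquiv v).2
      W.selmerGroup 2 ≤ MazurRubin2010.strictLocalKer W ℚ_[((primesEquiv v : Nat.Primes) : ℕ)] 2) :
    ∀ c ∈ (W.kummerSelmerStructure ((2 : ℕ) : ℤ)).selmerGroup,
      galoisCohomology.localization (W.torsionGaloisModule ((2 : ℕ) : ℤ)) (Sum.inr v) 1 c = 0 := by
  haveI := Fact.mk (primesEquiv v).2
  letI : Algebra ℚ (v.adicCompletion ℚ) := inferInstance
  haveI : CharZero (v.adicCompletion ℚ) :=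
    Literature.NumberTheory.GaloisRepresentations.charZero_adicCompletion v
  have h' : W.selmerGroup ((2 : ℕ) : ℤ) ≤
      W.torsionLocalKer ℚ_[((primesEquiv v : Nat.Primes) : ℕ)] ((2 : ℕ) : ℤ) := h
  intro c hc
  rw [← selmerGroup_eq_selmerGroup_kummerSelmerStructure] at hc
  have h1 : c ∈ W.torsionLocalKer (v.adicCompletion ℚ) ((2 : ℕ) : ℤ) :=
    (GenusKolyTwistingPrime.mem_torsionLocalKer_padic_iff W
      (RingEquivClass.toRingEquiv (Rat.HeightOneSpectrum.adicCompletion.padicEquiv (R := 𝓞 ℚ) v))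
      ((2 : ℕ) : ℤ) c).mp (h' hc)
  exact (mem_torsionLocalKer_iff_localization_eq_zero_rat W v c).mp h1

/-! ## §I Mazur–Rubin Cor. 3.4 (i) with `T = {q}` over `ℚ` HOLDS -/

section Main

open Literature.NumberTheory.QuadraticFields
open Summit.BirchSwinnertonDyer.BirchSwinnertonDyer.Theorems.GenusKolyTwistingPrime (primesEquiv_eq natCast_not_mem_of_not_dvd)
open Summit.BirchSwinnertonDyer.BirchSwinnertonDyer.Theorems.GenusKolyTwistRamified
  (valuation_natCast_eq_exp_neg_one_of_mem closureEmb_geomSqrt_not_mem_maxUnramified_rat)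

/-- **MAZUR–RUBIN 2010 COR. 3.4 (i) WITH ONE `T`-PRIME OVER `ℚ` HOLDS** — DISCHARGE of the named fact `MazurRubin2010.cor34i_singleton_rat`,
for EVERY elliptic `E/ℚ` (no Galois-image hypothesis). Under the splitting list of Prop. 3.3 (`K = ℚ`), a ramified prime `q` with
`#E(ℚ_q)[2] = 2`, all other ramified primes silent, and any model `W'` of `E^{(d)}`: `Sel₂(E)` strict at `q` ⟹ `#Sel₂(W') = 2·#Sel₂(E)`;
not strict ⟹ `#Sel₂(E) = 2·#Sel₂(W')`. Proof: the dictionary of the LEAD's `cor34ii_rat_holds` to the four-row menu at every place `≠ q`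
(SPLIT / TAMAGAWA-ODD / BOTH GOOD / SILENT; real place split or `H¹ = 0`), `q` good-odd-ramified with `#E(ℚ_{v_q})[2] = 2`, then §79
(PT, Tate χ, Lemmas 2.9–2.11 and Kramer's congruence for the framed canonical identification — all tree theorems).
[cite: MazurRubin2010, Cor. 3.4 (i) with Prop. 3.3, Def. 3.1 and Lemmas 2.10–2.11 (DASH copy p0008 L26–L60, p0009 L63–L83, p0010 L1–L24)]
[cite: Kramer1981, Thm. 1, Props. 1, 2, 7] [cite: MilneADT2006, I Thm. 2.8, 4.10] -/
theorem _root_.Literature.NumberTheory.EllipticCurves.MazurRubin2010.cor34i_singleton_rat_holds :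
    MazurRubin2010.cor34i_singleton_rat := by
  intro W _ d hsf hd1 F _ _ h2 hx h1 h2' h3 h4 h5 q _ hqdisc hq2 hT W' _ hW'
  classical
  have hd0 : d ≠ 0 := fun h ↦ by subst h; exact not_squarefree_zero hsf
  have hdQ : (d : ℚ) ≠ 0 := by exact_mod_cast hd0
  obtain ⟨x, hx⟩ := hx
  haveI hEt := W.isElliptic_quadraticTwist hdQ
  have hq : q.Prime := Fact.out
  -- `2` splits in `F`, so `d_F ≡ 1 (mod 8)` and `d_F = d`
  have h8 : NumberField.discr F % 8 = 1 := (Quadratic.ncard_primesOver_two_eq_two_iff h2).mp h3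
  have hdiscd : NumberField.discr F = d := by
    rcases discr_eq_or_eq_four_mul h2 hx hsf hd1 with h | h
    · exact h
    · exfalso; omega
  have hqd : (q : ℤ) ∣ d := hdiscd ▸ hqdisc
  -- `q` is odd
  have hq2' : q ≠ 2 := by
    rintro rfl
    have h2d : (2 : ℤ) ∣ NumberField.discr F := by exact_mod_cast hqdisc
    omega
  -- ramified odd primes do not split
  have hnotsplit : ∀ (p : ℕ) [Fact p.Prime], p ≠ 2 → (p : ℤ) ∣ NumberField.discr F →
      ((Ideal.span {(p : ℤ)}).primesOver (𝓞 F)).ncard ≠ 2 := by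
    intro p _ hp2 hpd h
    rw [Quadratic.ncard_primesOver_eq_two_iff_legendreSym h2 hp2,
      (legendreSym.eq_zero_iff p _).mpr ((ZMod.intCast_zmod_eq_zero_iff_dvd _ p).mpr hpd)] at h
    exact zero_ne_one h
  -- the place `v₀` of `ℚ` over `q`
  obtain ⟨v₀, hv₀⟩ : ∃ v : HeightOneSpectrum (𝓞 ℚ), ((primesEquiv v : Nat.Primes) : ℕ) = q :=
    ⟨primesEquiv.symm ⟨q, hq⟩, by rw [Equiv.apply_symm_apply]⟩
  subst hv₀
  have hqv₀ : (((primesEquiv v₀ : Nat.Primes) : ℕ) : 𝓞 ℚ) ∈ v₀.asIdeal := natCast_natGenerator_mem v₀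
  have h2v₀ : ((2 : ℕ) : 𝓞 ℚ) ∉ v₀.asIdeal :=
    natCast_not_mem_of_not_dvd hq hqv₀ fun h ↦ hq2' ((Nat.prime_dvd_prime_iff_eq hq Nat.prime_two).mp h)
  -- `W` has GOOD reduction at `v₀`
  have hW : W.HasGoodReductionAt v₀ := by
    rcases W.hasGoodReductionAt_or_hasMultiplicativeReductionAt_or_hasAdditiveReductionAt v₀ with hgood | hmult | hadd
    · exact hgood
    · exfalso
      have hmultp : W.HasMultiplicativeReductionAtPrime ((primesEquiv v₀ : Nat.Primes) : ℕ) :=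
        (hasMultiplicativeReductionAtPrime_iff_hasMultiplicativeReductionAt_ringOfIntegers W v₀).mpr hmult
      rcases Int.even_or_odd (padicValRat ((primesEquiv v₀ : Nat.Primes) : ℕ) W.Δ) with hev | hodd
      · exact hnotsplit _ hq2' hqdisc (h2' _ hmultp hev)
      · exact h5 _ hmultp hodd hqdisc
    · exfalso
      have hng : ¬ W.HasGoodReductionAtPrime ((primesEquiv v₀ : Nat.Primes) : ℕ) := fun h ↦
        hadd.not_hasGoodReductionAt ((hasGoodReductionAtPrime_iff_hasGoodReductionAt_ringOfIntegers v₀ W).mp h)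
      have hnm : ¬ W.HasMultiplicativeReductionAtPrime ((primesEquiv v₀ : Nat.Primes) : ℕ) := fun h ↦
        hadd.not_hasMultiplicativeReductionAt
          ((hasMultiplicativeReductionAtPrime_iff_hasMultiplicativeReductionAt_ringOfIntegers W v₀).mp h)
      exact hnotsplit _ hq2' hqdisc (h1 _ hng hnm)
  -- `v₀(d) = 1`: `ι(√d) ∉ ℚ_{v₀}^{nr}`
  have hram : closureEmb (K := ℚ) (v₀.adicCompletion ℚ) (geomSqrt (d : ℚ)) ∉ maxUnramified (v₀.adicCompletion ℚ) := by
    apply closureEmb_geomSqrt_not_mem_maxUnramified_rat v₀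
    obtain ⟨m, hm⟩ := hqd
    have hqm : ¬ (((primesEquiv v₀ : Nat.Primes) : ℕ) : ℤ) ∣ m := fun hm' ↦ by
      have hsq : (((primesEquiv v₀ : Nat.Primes) : ℕ) : ℤ) * ((primesEquiv v₀ : Nat.Primes) : ℕ) ∣ d := by
        rw [hm]; exact mul_dvd_mul_left _ hm'
      have hu := hsf _ hsq
      rw [Int.isUnit_iff] at hu
      rcases hu with hu | hu
      · exact hq.one_lt.ne' (by exact_mod_cast hu)
      · have : (0 : ℤ) ≤ (((primesEquiv v₀ : Nat.Primes) : ℕ) : ℤ) := by positivity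
        omega
    rw [show ((d : ℤ) : ℚ) = ((((primesEquiv v₀ : Nat.Primes) : ℕ) : ℕ) : ℚ) * ((m : ℤ) : ℚ) by rw [hm]; push_cast; ring,
      Valuation.map_mul, valuation_natCast_eq_exp_neg_one_of_mem v₀ hq hqv₀,
      valuation_intCast_eq_one_of_not_dvd (K := ℚ) (v := v₀) hq hqv₀ hqm, mul_one]
  -- `#W(ℚ_{v₀})[2] = 2`
  have ht : Nat.card (nsmulAddMonoidHom 2 : (W.baseChange (v₀.adicCompletion ℚ)).toAffine.Point →+ _).ker = 2 := by
    rw [natCard_ker_nsmul_adicCompletion_eq_padic W v₀ 2]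
    exact hq2
  -- the four-row finite place menu for the pair `(W, W^{(d)})` at every `v ≠ v₀`
  have hfin : ∀ v : HeightOneSpectrum (𝓞 ℚ), v ≠ v₀ →
      (∃ s : v.adicCompletion ℚ, s ^ 2 = algebraMap ℚ (v.adicCompletion ℚ) (d : ℚ)) ∨
      (((2 : ℕ) : 𝓞 ℚ) ∉ v.asIdeal ∧
        ¬ 2 ∣ (W.baseChange (v.adicCompletion ℚ)).localTamagawaNumber (v.adicCompletionIntegers ℚ) ∧
        ¬ 2 ∣ ((W.quadraticTwist (d : ℚ)).baseChange (v.adicCompletion ℚ)).localTamagawaNumber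
          (v.adicCompletionIntegers ℚ)) ∨
      (((2 : ℕ) : 𝓞 ℚ) ∉ v.asIdeal ∧ W.HasGoodReductionAt v ∧ (W.quadraticTwist (d : ℚ)).HasGoodReductionAt v) ∨
      (((2 : ℕ) : 𝓞 ℚ) ∉ v.asIdeal ∧
        Nat.card (nsmulAddMonoidHom 2 : (W.baseChange (v.adicCompletion ℚ)).toAffine.Point →+ _).ker = 1 ∧
        Nat.card (nsmulAddMonoidHom 2 :
          ((W.quadraticTwist (d : ℚ)).baseChange (v.adicCompletion ℚ)).toAffine.Point →+ _).ker = 1) := by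
    intro v hv
    haveI hF : Fact ((primesEquiv v : Nat.Primes) : ℕ).Prime := ⟨(primesEquiv v).2⟩
    by_cases hsplit : ((Ideal.span {(((primesEquiv v : Nat.Primes) : ℕ) : ℤ)}).primesOver (𝓞 F)).ncard = 2
    · exact Or.inl (exists_sq_eq_adicCompletion_of_ncard_primesOver_eq_two h2 hx hsf hd1 v hsplit)
    · -- `v` does not split: in particular `v ∤ 2`
      have hp2 : ((primesEquiv v : Nat.Primes) : ℕ) ≠ 2 := by
        intro hp2
        apply hsplit
        rw [hp2]
        exact h3
      have h2v : ((2 : ℕ) : 𝓞 ℚ) ∉ v.asIdeal := fun h ↦ hp2 (primesEquiv_eq Nat.prime_two h)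
      rcases W.hasGoodReductionAt_or_hasMultiplicativeReductionAt_or_hasAdditiveReductionAt v with
        hgood | hmult | hadd
      · by_cases hpd : (((primesEquiv v : Nat.Primes) : ℕ) : ℤ) ∣ d
        · -- ramified prime of good reduction OTHER than `q`: SILENT row
          have hpdisc : (((primesEquiv v : Nat.Primes) : ℕ) : ℤ) ∣ NumberField.discr F := hdiscd ▸ hpd
          have hpq : ((primesEquiv v : Nat.Primes) : ℕ) ≠ ((primesEquiv v₀ : Nat.Primes) : ℕ) := fun h ↦
            hv (primesEquiv.injective (Subtype.ext h))
          have hW2 := hT ((primesEquiv v : Nat.Primes) : ℕ) hpdisc hpq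
          refine Or.inr (Or.inr (Or.inr ⟨h2v, natCard_ker_nsmul_two_adicCompletion_eq_one_of_forall W v hW2, ?_⟩))
          refine natCard_ker_nsmul_two_adicCompletion_eq_one_of_forall (W.quadraticTwist (d : ℚ)) v ?_
          have hc : Nat.card {Q : ((W.quadraticTwist (d : ℚ)).baseChange
              ℚ_[((primesEquiv v : Nat.Primes) : ℕ)]).toAffine.Point // 2 • Q = 0} = 1 := by
            rw [natCard_twoTorsion_padic_twist_eq W hdQ (Wd := W.quadraticTwist (d : ℚ)) (C := 1) (one_smul _ _)]
            haveI : Unique {Q : (W.baseChange ℚ_[((primesEquiv v : Nat.Primes) : ℕ)]).toAffine.Point // 2 • Q = 0} :=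
              { default := ⟨0, by simp⟩
                uniq := fun Q ↦ Subtype.ext (hW2 Q.1 Q.2) }
            exact Nat.card_unique
          intro Q hQ
          haveI : Finite {Q : ((W.quadraticTwist (d : ℚ)).baseChange
              ℚ_[((primesEquiv v : Nat.Primes) : ℕ)]).toAffine.Point // 2 • Q = 0} :=
            Nat.finite_of_card_ne_zero (by rw [hc]; norm_num)
          exact congrArg Subtype.val ((Nat.card_eq_one_iff_unique.mp hc).1.elim ⟨Q, hQ⟩ ⟨0, by simp⟩)
        · -- unramified prime of good reduction: BOTH GOOD
          exact Or.inr (Or.inr (Or.inl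
            ⟨h2v, hgood, hasGoodReductionAt_quadraticTwist_of_not_dvd_any W v hp2 hpd hgood⟩))
      · -- multiplicative prime: `ord Δ` even would split, so it is odd and unramified: TAMAGAWA row
        have hmultp : W.HasMultiplicativeReductionAtPrime ((primesEquiv v : Nat.Primes) : ℕ) :=
          (hasMultiplicativeReductionAtPrime_iff_hasMultiplicativeReductionAt_ringOfIntegers W v).mpr hmult
        rcases Int.even_or_odd (padicValRat ((primesEquiv v : Nat.Primes) : ℕ) W.Δ) with hev | hodd
        · exact absurd (h2' _ hmultp hev) hsplit
        · have hpdisc := h5 _ hmultp hodd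
          have hpd : ¬ (((primesEquiv v : Nat.Primes) : ℕ) : ℤ) ∣ d := hdiscd ▸ hpdisc
          refine Or.inr (Or.inl ⟨h2v, ?_, ?_⟩)
          · exact not_two_dvd_localTamagawaNumber_of_mult_of_odd W v hmult
              ((odd_ordMinimalDiscriminant_iff_odd_padicValRat W v).mpr hodd)
          · exact not_two_dvd_localTamagawaNumber_of_mult_of_odd (W.quadraticTwist (d : ℚ)) v
              (hasMultiplicativeReductionAt_quadraticTwist_of_not_dvd_any W v hp2 hpd hmult)
              ((odd_ordMinimalDiscriminant_iff_odd_padicValRat _ v).mpr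
                ((odd_padicValRat_Δ_quadraticTwist_iff W hpd).mpr hodd))
      · -- additive prime: it splits by hypothesis — contradiction
        have hng : ¬ W.HasGoodReductionAtPrime ((primesEquiv v : Nat.Primes) : ℕ) := fun h ↦
          hadd.not_hasGoodReductionAt ((hasGoodReductionAtPrime_iff_hasGoodReductionAt_ringOfIntegers v W).mp h)
        have hnm : ¬ W.HasMultiplicativeReductionAtPrime ((primesEquiv v : Nat.Primes) : ℕ) := fun h ↦
          hadd.not_hasMultiplicativeReductionAt
            ((hasMultiplicativeReductionAtPrime_iff_hasMultiplicativeReductionAt_ringOfIntegers W v).mp h)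
        exact absurd (h1 _ hng hnm) hsplit
  -- the infinite place menu
  have hinf : ∀ w : InfinitePlace ℚ,
      (∃ s : w.Completion, s ^ 2 = algebraMap ℚ w.Completion (d : ℚ)) ∨
      ((∀ y : galoisCohomology (W.localGaloisModule w.Completion) 1, y = 0) ∧
        (∀ y : galoisCohomology ((W.quadraticTwist (d : ℚ)).localGaloisModule w.Completion) 1, y = 0)) := by
    intro w
    rcases lt_or_gt_of_ne W.isUnit_Δ.ne_zero with hneg | hpos
    · right
      have hneg' : (W.quadraticTwist (d : ℚ)).Δ < 0 := by
        rw [quadraticTwist_Δ]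
        exact mul_neg_of_pos_of_neg (by positivity) hneg
      exact ⟨fun y ↦ GenusExact.ArchVanishing.localH1_infinitePlace_eq_zero_of_Δ_neg W w hneg y,
        fun y ↦ GenusExact.ArchVanishing.localH1_infinitePlace_eq_zero_of_Δ_neg _ w hneg' y⟩
    · left
      haveI := h4 hpos
      have hdpos : 0 < d := pos_of_isTotallyReal_of_sq_eq hx hd0
      obtain ⟨m, hm⟩ : ∃ m : ℕ, (m : ℤ) = d := ⟨d.natAbs, Int.natAbs_of_nonneg hdpos.le⟩
      obtain ⟨s, hs⟩ := GenusKolyLowering.exists_sq_eq_infinitePlace_completion w m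
      refine ⟨s, ?_⟩
      rw [hs, ← hm, Int.cast_natCast]
  -- §79 for the twist `W^{(d)}` itself, then transport to the given model `W'`
  have key := natCard_selmerGroup_twist_directed_of_menu_frame W (W.quadraticTwist (d : ℚ)) hdQ (C := 1) (one_smul _ _)
    v₀ h2v₀ hW hram ht hfin hinf
  obtain ⟨C, hC⟩ := hW'
  have hsm := natCard_selmerGroup_smul W' C two_ne_zero
  rw [hC] at hsm
  rw [Nat.cast_ofNat] at key hsm
  refine ⟨fun hle ↦ ?_, fun hnle ↦ ?_⟩
  · have h := key.1 (forall_selmer_localization_eq_zero_of_le_strictLocalKer W v₀ hle)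
    rw [← hsm, h, mul_comm]
  · have h := key.2 (exists_selmer_localization_ne_zero_of_not_le_strictLocalKer W v₀ hnle)
    rw [← hsm, ← h, mul_comm]

end Main

end Summit.BirchSwinnertonDyer.BirchSwinnertonDyer.Theorems.GenusKolyTwistTamagawa

end
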